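import Summits.Ventures.Crystal3D.Theorems.StickyWulffConstantNoReconstructionGainGrainFrameTwoFilm
import HarnessLib

/-!
# Misoriented fcc grains (subsets of one moved lattice) with at most two substrate contacts per ball

HONEST FRAMING. Part of the venture `Summits/Ventures/Crystal3D` (cell `crystal3d-full`), helper
`--supports` the crux `NoReconstructionGain` (stmt-Ventures-19144, route
`route-Ventures-StickyWulffConstant`), line `adhesion` (wulff-p1 g11).  The rung `grainFilm_slab_two`
(`…GrainFrameTwoFilm`) in the vocabulary of the census: the film is a subset of ONE MOVED LATTICE
`A Λ₀ + s` (`A` any linear isometry, `s` any translation — a misoriented fcc grain of any orientation,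
position and shape, vacancies allowed), with no frame set `U₀` in the statement.

* `grainFilm_slab_two_movedLattice` — for such films above the cut whose balls each touch at most two
  substrate balls: `#cross(P, X∖P) ≤ D(X∖P)` (`R = 1`, `C = 0`), at every unit normal.

WHAT THIS IS NOT: three substrate contacts per ball (hollow sites) need the open three-contact cap budget
(`stub_frameCapBudget`); rung F-C1 not moved.
-/

noncomputable section

namespace Summit.Ventures.Crystal3D.Theorems

open Summit.Ventures.Crystal3D Finset
open Literature.MathematicalPhysics.StatisticalMechanics (fccStacking barlowPos constHagg orderedContacts
  contactDeficiency)
open scoped InnerProductSpace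

/-- **RUNG: misoriented fcc grains with at most two substrate contacts per ball gain nothing, every
normal** (moved-lattice form of `grainFilm_slab_two`; `R = 1`, `C = 0`). -/
theorem grainFilm_slab_two_movedLattice :
    ∃ R C : ℝ, 1 ≤ R ∧ ∀ (A : EuclideanSpace ℝ (Fin 3) ≃ₗᵢ[ℝ] EuclideanSpace ℝ (Fin 3))
      (s : EuclideanSpace ℝ (Fin 3)),
      ∀ ν : EuclideanSpace ℝ (Fin 3), ‖ν‖ = 1 → ∀ ρ : ℝ, R ≤ ρ →
      ∀ X P : Finset (EuclideanSpace ℝ (Fin 3)),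
      (∀ p ∈ X, ∀ q ∈ X, p ≠ q → 1 ≤ dist p q) → P ⊆ X →
      (∀ p, p ∈ P ↔ (p ∈ fccStacking 1 (Real.sqrt (2 / 3)) ∧ -(2 * R) ≤ ⟪p, ν⟫_ℝ ∧
        ⟪p, ν⟫_ℝ ≤ -R ∧ ‖p‖ ^ 2 - ⟪p, ν⟫_ℝ ^ 2 ≤ ρ ^ 2)) →
      (∀ q ∈ X \ P, -R < ⟪q, ν⟫_ℝ) →
      (∀ q ∈ X \ P, q ∈ (fun p => A p + s) '' fccStacking 1 (Real.sqrt (2 / 3))) →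
      (∀ q ∈ X \ P, (P.filter fun p => dist q p = 1).card ≤ 2) →
      ((((P ×ˢ (X \ P)).filter fun pq => dist pq.1 pq.2 = 1).card : ℕ) : ℝ) ≤
        contactDeficiency (X \ P) + C * ρ := by
  classical
  obtain ⟨R, C, hR, h⟩ := grainFilm_slab_two
  refine ⟨R, C, hR, ?_⟩
  intro A s ν hν ρ hρ X P hX hPX hP habove hgrain h2
  -- the explicit bond star
  set U₀ : Finset (EuclideanSpace ℝ (Fin 3)) :=
    ([barlowPos 1 (Real.sqrt (2 / 3)) constHagg 0 1 0, -barlowPos 1 (Real.sqrt (2 / 3)) constHagg 0 1 0,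
        barlowPos 1 (Real.sqrt (2 / 3)) constHagg 0 0 1, -barlowPos 1 (Real.sqrt (2 / 3)) constHagg 0 0 1,
        barlowPos 1 (Real.sqrt (2 / 3)) constHagg 0 1 (-1), -barlowPos 1 (Real.sqrt (2 / 3)) constHagg 0 1 (-1),
        barlowPos 1 (Real.sqrt (2 / 3)) constHagg 1 0 0, -barlowPos 1 (Real.sqrt (2 / 3)) constHagg 1 0 0,
        barlowPos 1 (Real.sqrt (2 / 3)) constHagg (-1) 1 0, -barlowPos 1 (Real.sqrt (2 / 3)) constHagg (-1) 1 0,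
        barlowPos 1 (Real.sqrt (2 / 3)) constHagg (-1) 0 1, -barlowPos 1 (Real.sqrt (2 / 3)) constHagg (-1) 0 1] :
        List (EuclideanSpace ℝ (Fin 3))).toFinset with hU₀
  have hU₀mem : ∀ d ∈ U₀, d ∈ fccStacking 1 (Real.sqrt (2 / 3)) ∧ ‖d‖ = 1 := fun d hd => fccBondStar_mem hd
  have hU₀neg : ∀ d ∈ U₀, -d ∈ U₀ := fun d hd => fccBondStar_neg_mem hd
  have hU₀card : U₀.card = 12 := fccBondStar_card
  -- film bonds are moved lattice vectors
  have hreg : ∀ q ∈ X \ P, ∀ x ∈ X \ P, dist q x = 1 →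
      A.symm (x - q) ∈ fccStacking 1 (Real.sqrt (2 / 3)) := by
    intro q hq x hx _
    obtain ⟨μ, hμ, hq'⟩ := hgrain q hq
    obtain ⟨κ, hκ, hx'⟩ := hgrain x hx
    have e1 : x = A κ + s := hx'.symm
    have e2 : q = A μ + s := hq'.symm
    have hxq : x - q = A (κ - μ) := by rw [e1, e2, map_sub]; abel
    rw [hxq, LinearIsometryEquiv.symm_apply_apply]
    obtain ⟨k, i, j, rfl⟩ := hκ
    obtain ⟨k', i', j', rfl⟩ := hμ
    exact ⟨k - k', i - i', j - j', barlowPos_fcc_sub k i j k' i' j'⟩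
  exact h U₀ hU₀mem hU₀neg hU₀card A ν hν ρ hρ X P hX hPX hP habove h2 hreg

end Summit.Ventures.Crystal3D.Theorems

end
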